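import Summits.ValiantsHypothesis.ValiantsHypothesis.Theorems.KPlusLogSqLawTridiagonalRealStaticUnitSturmWindowCount
import Summits.ValiantsHypothesis.ValiantsHypothesis.Theorems.KPlusLogSqLawTridiagonalRealStaticUnitWronskian

/-!
# Route «KPlusLogSqLaw», crux `WeakLifting` (stmt-ValiantsHypothesis-19561) — REAL side of the tridiagonal sector:
# the UNIT-COEFFICIENT sub-sector — SPLITTING AT A DEGENERATE ZERO; the crossing-direction law at EVERY zero (non-degeneracy removed)

HONEST FRAMING.  Helper theorems (`--supports stmt-ValiantsHypothesis-19561 --as helper`), seat val-sym-lift-p1 (g19), cell `pub-symmetroid`,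
2026-08-28; successor of the g18 package (`…UnitCrossingDirection` p633123, `…UnitKernelVector` p633729, `…UnitWronskian` p635395,
`…UnitSturmWindowCount` p637784).  Continuants `D_k = pathDet (fun _ => 1) d (fun _ => 1) f k` of a unit-coefficient static symmetric
tridiagonal design (`D_{k+2} = x^{d_{k+1}}D_{k+1} − x^{2f_k}D_k`), edge slopes `L_k = 2f_k − d_k − d_{k+1}`, `F_k = f_0 + ⋯ + f_{k−1}`, slope energy
`Σ_{k<m−1} L_k·D_kD_{k+1}x^{−2F_k}` at a zero `x` of `D_m` (its sign is the crossing direction of the zero eigenvalue, p633729/p635395).  The g18 laws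
assume the zero NON-DEGENERATE (`D_1, …, D_{m−1} ≠ 0` at `x`).  Proved here (all exponents):
* WHERE CONTINUANTS VANISH (`eval_succ_ne_zero_of_eval_eq_zero`, `eval_two_pos_below_one`): two consecutive continuants never vanish together at
  `x > 0`, and `D_1, D_2 > 0` on `(0,1)` when the first slope is positive;
* **SPLITTING IDENTITY** (`eval_shift_of_eval_eq_zero`): if `D_{i+1}(x) = 0` then `D_{i+2+j}(x) = −x^{2f_i}D_i(x)·D′_j(x)` for every `j`, `D′` the
  continuants of the SHIFTED design `d′ = d(· + i + 2)`, `f′ = f(· + i + 2)` — the continuant kernel vector has a zero coordinate and the chain splits;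
* **ENERGY SPLITTING** (`slopeEnergy_split`): at such an `x` the slope energy of size `n₁ + n₂ + 5` with `D_{n₁+2}(x) = 0` equals the slope energy of
  the leading block (size `n₁ + 2`) plus `(x^{2f_{n₁+1}}D_{n₁+1}(x))²·x^{−2F_{n₁+3}}` times the slope energy of the trailing block (size `n₂ + 2`,
  shifted design) — both blocks are singular at `x`;
* **CROSSING-DIRECTION LAW AT EVERY ZERO, `3 ≤ m ≤ 8`** (`slopeEnergy_pos_below_one_of_le_eight`): below the resonance (`0 < x < 1`), all slopes
  positive, at EVERY zero of `D_m` — degenerate or not — the slope energy is positive (strong induction on `m`: a degenerate zero splits into two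
  singular blocks of sizes `≥ 3`, each positive by induction; the non-degenerate case is g18's `slopeEnergy_balance_pos_of_le_eight`);
* the ALL-SIZES form (`slopeEnergy_pos_below_one_of_weakSep`) under the WEAK separation hypothesis «no two NEGATIVE pivot products `D_kD_{k+1} < 0`,
  `D_{k+3}D_{k+4} < 0` three edges apart» (which passes to both blocks), again at every zero;
* consequences at every zero (`3 ≤ m ≤ 8`, slopes positive, `0 < x < 1`): NEGATIVE TYPE of every kernel vector of the evaluated pencil
  (`negType_below_one_sharp`) and the DERIVATIVE-SIGN LAW `D′_m(x)·D_{m−1}(x) < 0` (`deriv_mul_prev_neg_below_one_sharp`) — every zero in `(0,1)` is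
  simple and crossed towards one more negative eigenvalue (degenerate zeros exist from `m = 7` on: palindromic `3+1+3` designs).
Nothing here is an upper law for the register (α NO MOVER); nothing bears on `WeakLifting` / `TropicalB` (stmt-19771) in their windows, Conjecture B,
the Door-A registers, `MatrixDescartes` (stmt-18050) or VP ≠ VNP.
[this seat; folklore: continuants, kernel vectors of Jacobi matrices, interlacing / splitting at a vanishing coordinate]
-/

-- `Summit.ValiantsHypothesis.ValiantsHypothesis.…` repeats a component by the D-0017 layout (single-conjunct summit); the name is mandated.
set_option linter.dupNamespace false
set_option autoImplicit false

namespace Summit.ValiantsHypothesis.ValiantsHypothesis.Theorems.KPlusLogSqLaw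
namespace StaticTridiagonalRealUnit

open Real Finset Polynomial Matrix
open Summit.ValiantsHypothesis.ValiantsHypothesis.Theorems.KPlusLogSqLaw.StaticTridiagonalRealPotential (pathDet)

variable (d : ℕ → ℕ) (f : ℕ → ℕ)

/-! ### 1. Where continuants can vanish -/

/-- two consecutive continuants never vanish together at `x > 0` (`D_0 = 1` and the recurrence run backwards). [this file] -/
theorem eval_succ_ne_zero_of_eval_eq_zero (x : ℝ) (hx : 0 < x) :
    ∀ k, (pathDet (fun _ => (1 : ℝ)) d (fun _ => (1 : ℝ)) f (k + 1)).eval x = 0 →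
      (pathDet (fun _ => (1 : ℝ)) d (fun _ => (1 : ℝ)) f k).eval x ≠ 0 := by
  intro k
  induction k with
  | zero =>
    intro _ h0
    rw [(eval_unit_zero_one d f x).1] at h0
    exact one_ne_zero h0
  | succ k ih =>
    intro hk2 hk1
    have hrec := eval_unit_add_two d f x k
    rw [show k + 2 = k + 1 + 1 by omega, hk2, hk1, mul_zero, zero_sub] at hrec
    have hxk : x ^ (2 * f k) ≠ 0 := pow_ne_zero _ hx.ne'
    have hk0 : (pathDet (fun _ => (1 : ℝ)) d (fun _ => (1 : ℝ)) f k).eval x = 0 := by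
      rcases mul_eq_zero.1 (neg_eq_zero.1 hrec.symm) with h | h
      · exact absurd h hxk
      · exact h
    exact ih hk1 hk0

/-- `D_1 > 0` and, when the first slope is positive, `D_2 > 0` on `(0,1)`: blocks of sizes `1` and `2` are never singular below the resonance.
[this file] -/
theorem eval_two_pos_below_one (x : ℝ) (hx : 0 < x) (hx1 : x < 1) (h0 : d 0 + d 1 < 2 * f 0) :
    0 < (pathDet (fun _ => (1 : ℝ)) d (fun _ => (1 : ℝ)) f 1).eval x ∧
      0 < (pathDet (fun _ => (1 : ℝ)) d (fun _ => (1 : ℝ)) f 2).eval x := by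
  obtain ⟨e0, e1⟩ := eval_unit_zero_one d f x
  have e2 := eval_unit_add_two d f x 0
  simp only [zero_add] at e2
  refine ⟨by rw [e1]; exact pow_pos hx _, ?_⟩
  rw [e2, e1, e0, mul_one, ← pow_add, add_comm]
  have := pow_lt_pow_right_of_lt_one₀ hx hx1 h0
  linarith

/-! ### 2. The splitting identity -/

/-- **SPLITTING IDENTITY (all sizes, all `x`)**: if `D_{i+1}(x) = 0` then for every `j`
`D_{i+2+j}(x) = −x^{2f_i}·D_i(x)·D′_j(x)`, where `D′` are the continuants of the shifted design `d′ = d(· + (i+2))`, `f′ = f(· + (i+2))`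
(given as functions `d' f'` with their defining equations). [this file] -/
theorem eval_shift_of_eval_eq_zero (x : ℝ) (i : ℕ) (d' f' : ℕ → ℕ) (hd' : ∀ k, d' k = d (k + (i + 2))) (hf' : ∀ k, f' k = f (k + (i + 2)))
    (hi : (pathDet (fun _ => (1 : ℝ)) d (fun _ => (1 : ℝ)) f (i + 1)).eval x = 0) (j : ℕ) :
    (pathDet (fun _ => (1 : ℝ)) d (fun _ => (1 : ℝ)) f (i + 2 + j)).eval x =
      -(x ^ (2 * f i) * (pathDet (fun _ => (1 : ℝ)) d (fun _ => (1 : ℝ)) f i).eval x) *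
        (pathDet (fun _ => (1 : ℝ)) d' (fun _ => (1 : ℝ)) f' j).eval x := by
  -- prove the pair `(j, j+1)` by induction on `j`
  suffices h : ∀ j, (pathDet (fun _ => (1 : ℝ)) d (fun _ => (1 : ℝ)) f (i + 2 + j)).eval x =
      -(x ^ (2 * f i) * (pathDet (fun _ => (1 : ℝ)) d (fun _ => (1 : ℝ)) f i).eval x) *
        (pathDet (fun _ => (1 : ℝ)) d' (fun _ => (1 : ℝ)) f' j).eval x ∧
      (pathDet (fun _ => (1 : ℝ)) d (fun _ => (1 : ℝ)) f (i + 2 + (j + 1))).eval x =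
      -(x ^ (2 * f i) * (pathDet (fun _ => (1 : ℝ)) d (fun _ => (1 : ℝ)) f i).eval x) *
        (pathDet (fun _ => (1 : ℝ)) d' (fun _ => (1 : ℝ)) f' (j + 1)).eval x from (h j).1
  intro j
  induction j with
  | zero =>
    obtain ⟨e0', e1'⟩ := eval_unit_zero_one d' f' x
    have e2 := eval_unit_add_two d f x i
    have e3 := eval_unit_add_two d f x (i + 1)
    rw [show i + 1 + 1 = i + 2 by omega] at e3
    refine ⟨?_, ?_⟩
    · rw [show i + 2 + 0 = i + 2 by omega, e2, hi, e0']; ring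
    · rw [show i + 2 + (0 + 1) = i + 1 + 2 by omega, e3, e2, hi, e1', hd' 0, zero_add]; ring
  | succ j ih =>
    obtain ⟨hj, hj1⟩ := ih
    refine ⟨hj1, ?_⟩
    have e := eval_unit_add_two d f x (i + 2 + j)
    have e' := eval_unit_add_two d' f' x j
    rw [show i + 2 + (j + 1 + 1) = i + 2 + j + 2 by omega, e, show i + 2 + j + 1 = i + 2 + (j + 1) by omega, hj1, hj, e',
      hd' (j + 1), hf' j, show j + 1 + (i + 2) = i + 2 + j + 1 by omega, show j + (i + 2) = i + 2 + j by omega]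
    ring

/-! ### 3. Splitting of the slope energy -/

/-- **ENERGY SPLITTING**: at `x > 0` with `D_{n₁+2}(x) = 0`, the slope energy of the size-`(n₁+n₂+5)` design equals the slope energy of its leading
block (size `n₁+2`) plus `(x^{2f_{n₁+1}}D_{n₁+1}(x))² / x^{2F_{n₁+3}}` times the slope energy of its trailing block (size `n₂+2`, the shifted design
`d′ = d(· + (n₁+3))`, `f′ = f(· + (n₁+3))`). [this file] -/
theorem slopeEnergy_split (x : ℝ) (hx : 0 < x) (n₁ n₂ : ℕ) (d' f' : ℕ → ℕ) (hd' : ∀ k, d' k = d (k + (n₁ + 3)))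
    (hf' : ∀ k, f' k = f (k + (n₁ + 3))) (hzero : (pathDet (fun _ => (1 : ℝ)) d (fun _ => (1 : ℝ)) f (n₁ + 2)).eval x = 0) :
    ∑ k ∈ range (n₁ + n₂ + 4), ((2 * (f k : ℝ)) - ((d k + d (k + 1) : ℕ) : ℝ)) *
        ((pathDet (fun _ => (1 : ℝ)) d (fun _ => (1 : ℝ)) f k).eval x * (pathDet (fun _ => (1 : ℝ)) d (fun _ => (1 : ℝ)) f (k + 1)).eval x /
          x ^ (2 * ∑ j ∈ range k, f j)) =
      ∑ k ∈ range (n₁ + 1), ((2 * (f k : ℝ)) - ((d k + d (k + 1) : ℕ) : ℝ)) *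
        ((pathDet (fun _ => (1 : ℝ)) d (fun _ => (1 : ℝ)) f k).eval x * (pathDet (fun _ => (1 : ℝ)) d (fun _ => (1 : ℝ)) f (k + 1)).eval x /
          x ^ (2 * ∑ j ∈ range k, f j)) +
      (x ^ (2 * f (n₁ + 1)) * (pathDet (fun _ => (1 : ℝ)) d (fun _ => (1 : ℝ)) f (n₁ + 1)).eval x) ^ 2 / x ^ (2 * ∑ j ∈ range (n₁ + 3), f j) *
      ∑ k ∈ range (n₂ + 1), ((2 * (f' k : ℝ)) - ((d' k + d' (k + 1) : ℕ) : ℝ)) *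
        ((pathDet (fun _ => (1 : ℝ)) d' (fun _ => (1 : ℝ)) f' k).eval x * (pathDet (fun _ => (1 : ℝ)) d' (fun _ => (1 : ℝ)) f' (k + 1)).eval x /
          x ^ (2 * ∑ j ∈ range k, f' j)) := by
  have hshift := eval_shift_of_eval_eq_zero d f x (n₁ + 1) d' f' (fun k => by rw [hd' k])
    (fun k => by rw [hf' k]) (by rw [show n₁ + 1 + 1 = n₁ + 2 by omega]; exact hzero)
  rw [show n₁ + n₂ + 4 = (n₁ + 3) + (n₂ + 1) by omega, sum_range_add, sum_range_succ, sum_range_succ,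
    show n₁ + 1 + 1 = n₁ + 2 by omega, hzero]
  simp only [mul_zero, zero_mul, zero_div, add_zero]
  rw [mul_sum]
  congr 1
  refine sum_congr rfl fun k _ => ?_
  have h1 := hshift k
  have h2 := hshift (k + 1)
  rw [show n₁ + 1 + 2 + k = n₁ + 3 + k by omega] at h1
  rw [show n₁ + 1 + 2 + (k + 1) = n₁ + 3 + k + 1 by omega] at h2
  have hF : ∑ j ∈ range (n₁ + 3 + k), f j = ∑ j ∈ range (n₁ + 3), f j + ∑ j ∈ range k, f' j := by
    rw [sum_range_add]
    exact congrArg _ (sum_congr rfl fun j _ => by rw [hf' j, add_comm])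
  rw [h1, h2, hF, hd' k, hd' (k + 1), hf' k, show k + (n₁ + 3) = n₁ + 3 + k by omega,
    show k + 1 + (n₁ + 3) = n₁ + 3 + k + 1 by omega, mul_add 2 (∑ j ∈ range (n₁ + 3), f j), pow_add]
  have hA : x ^ (2 * ∑ j ∈ range (n₁ + 3), f j) ≠ 0 := pow_ne_zero _ hx.ne'
  have hB : x ^ (2 * ∑ j ∈ range k, f' j) ≠ 0 := pow_ne_zero _ hx.ne'
  field_simp

/-! ### 4. Bookkeeping of a degenerate zero -/

/-- **DEGENERATE ZERO ⇒ TWO SINGULAR BLOCKS**: below the resonance with all slopes positive, if `D_{n₁+2}(x) = 0` and `D_m(x) = 0` with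
`n₁ + 2 < m`, then `m = n₁ + n₂ + 5` for some `n₂ ≥ 1`, the trailing block (shifted design `d′ = d(· + (n₁+3))`, `f′ = f(· + (n₁+3))`, size `n₂ + 2`)
is singular at `x`, its slopes are positive, and its pivot products are those of the big design from index `n₁ + 3` on, up to the positive factor
`(x^{2f_{n₁+1}}D_{n₁+1}(x))²`. [this file] -/
theorem degenerate_split (m n₁ : ℕ) (x : ℝ) (hx : 0 < x) (hx1 : x < 1)
    (hslope : ∀ k, k + 1 < m → d k + d (k + 1) < 2 * f k) (hlt : n₁ + 2 < m)
    (hDi : (pathDet (fun _ => (1 : ℝ)) d (fun _ => (1 : ℝ)) f (n₁ + 2)).eval x = 0)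
    (hroot : (pathDet (fun _ => (1 : ℝ)) d (fun _ => (1 : ℝ)) f m).eval x = 0)
    (d' f' : ℕ → ℕ) (hd' : ∀ k, d' k = d (k + (n₁ + 3))) (hf' : ∀ k, f' k = f (k + (n₁ + 3))) :
    ∃ n₂, m = n₁ + n₂ + 5 ∧ 1 ≤ n₂ ∧
      (pathDet (fun _ => (1 : ℝ)) d' (fun _ => (1 : ℝ)) f' (n₂ + 2)).eval x = 0 ∧
      (∀ k, k + 1 < n₂ + 2 → d' k + d' (k + 1) < 2 * f' k) ∧
      (x ^ (2 * f (n₁ + 1)) * (pathDet (fun _ => (1 : ℝ)) d (fun _ => (1 : ℝ)) f (n₁ + 1)).eval x ≠ 0) ∧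
      (∀ j, (pathDet (fun _ => (1 : ℝ)) d (fun _ => (1 : ℝ)) f (n₁ + 3 + j)).eval x *
          (pathDet (fun _ => (1 : ℝ)) d (fun _ => (1 : ℝ)) f (n₁ + 3 + j + 1)).eval x =
        (x ^ (2 * f (n₁ + 1)) * (pathDet (fun _ => (1 : ℝ)) d (fun _ => (1 : ℝ)) f (n₁ + 1)).eval x) ^ 2 *
          ((pathDet (fun _ => (1 : ℝ)) d' (fun _ => (1 : ℝ)) f' j).eval x *
            (pathDet (fun _ => (1 : ℝ)) d' (fun _ => (1 : ℝ)) f' (j + 1)).eval x)) := by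
  have hshift := eval_shift_of_eval_eq_zero d f x (n₁ + 1) d' f' (fun k => by rw [hd' k])
    (fun k => by rw [hf' k]) (by rw [show n₁ + 1 + 1 = n₁ + 2 by omega]; exact hDi)
  have hc : x ^ (2 * f (n₁ + 1)) * (pathDet (fun _ => (1 : ℝ)) d (fun _ => (1 : ℝ)) f (n₁ + 1)).eval x ≠ 0 :=
    mul_ne_zero (pow_ne_zero _ hx.ne') (eval_succ_ne_zero_of_eval_eq_zero d f x hx (n₁ + 1) hDi)
  have hslope' : ∀ k, k + 1 < m - (n₁ + 3) → d' k + d' (k + 1) < 2 * f' k := by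
    intro k hk
    rw [hd' k, hd' (k + 1), hf' k, show k + 1 + (n₁ + 3) = k + (n₁ + 3) + 1 by omega]
    exact hslope (k + (n₁ + 3)) (by omega)
  -- the trailing block is singular at `x`
  have hroot' : (pathDet (fun _ => (1 : ℝ)) d' (fun _ => (1 : ℝ)) f' (m - (n₁ + 3))).eval x = 0 := by
    have h := hshift (m - (n₁ + 3))
    rw [show n₁ + 1 + 2 + (m - (n₁ + 3)) = m by omega, hroot] at h
    rcases mul_eq_zero.1 h.symm with h1 | h1
    · exact absurd (neg_eq_zero.1 h1) hc
    · exact h1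
  -- hence it has size at least `3`
  have hs0 : m - (n₁ + 3) ≠ 0 := fun h => by
    rw [h, (eval_unit_zero_one d' f' x).1] at hroot'; exact one_ne_zero hroot'
  have hs1 : m - (n₁ + 3) ≠ 1 := fun h => by
    rw [h, (eval_unit_zero_one d' f' x).2] at hroot'; exact (pow_pos hx _).ne' hroot'
  have hs2 : m - (n₁ + 3) ≠ 2 := fun h => by
    have h2 := (eval_two_pos_below_one d' f' x hx hx1 (hslope' 0 (by omega))).2
    rw [h] at hroot'; exact h2.ne' hroot'
  obtain ⟨n₂, hn₂⟩ : ∃ n₂, m - (n₁ + 3) = n₂ + 2 := ⟨m - (n₁ + 3) - 2, by omega⟩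
  refine ⟨n₂, by omega, by omega, by rw [← hn₂]; exact hroot', fun k hk => hslope' k (by omega), hc, fun j => ?_⟩
  have h1 := hshift j
  have h2 := hshift (j + 1)
  rw [show n₁ + 1 + 2 + j = n₁ + 3 + j by omega] at h1
  rw [show n₁ + 1 + 2 + (j + 1) = n₁ + 3 + j + 1 by omega] at h2
  rw [h1, h2]; ring

/-! ### 5. The crossing-direction law at every zero -/

/-- **CROSSING-DIRECTION LAW AT EVERY ZERO (`3 ≤ m ≤ 8`, all exponents)**: below the resonance (`0 < x < 1`), all slopes positive, at EVERY zero
`x` of `D_m` — degenerate or not — the slope energy `Σ_{k<m−1} (2f_k − d_k − d_{k+1})·D_kD_{k+1}x^{−2F_k}` is positive: the zero eigenvalue moves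
down and the inertia count goes up.  (Non-degenerate zeros: g18 `slopeEnergy_balance_pos_of_le_eight`; a degenerate zero splits into two singular
blocks of sizes `≥ 3`, by strong induction.) [this file] -/
theorem slopeEnergy_pos_below_one_of_le_eight (m : ℕ) (hm : 3 ≤ m) (hm8 : m ≤ 8) (x : ℝ) (hx : 0 < x) (hx1 : x < 1)
    (hslope : ∀ k, k + 1 < m → d k + d (k + 1) < 2 * f k)
    (hroot : (pathDet (fun _ => (1 : ℝ)) d (fun _ => (1 : ℝ)) f m).eval x = 0) :
    0 < ∑ k ∈ range (m - 1), ((2 * (f k : ℝ)) - ((d k + d (k + 1) : ℕ) : ℝ)) *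
      ((pathDet (fun _ => (1 : ℝ)) d (fun _ => (1 : ℝ)) f k).eval x * (pathDet (fun _ => (1 : ℝ)) d (fun _ => (1 : ℝ)) f (k + 1)).eval x /
        x ^ (2 * ∑ j ∈ range k, f j)) := by
  revert d f
  induction m using Nat.strong_induction_on with
  | _ m ih =>
  intro d f hslope hroot
  by_cases hdeg : ∃ k, 0 < k ∧ k < m ∧ (pathDet (fun _ => (1 : ℝ)) d (fun _ => (1 : ℝ)) f k).eval x = 0
  · -- DEGENERATE ZERO: split at a vanishing continuant `D_i`, `3 ≤ i < m`
    obtain ⟨i, hi0, him, hDi⟩ := hdeg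
    obtain ⟨hD1, hD2⟩ := eval_two_pos_below_one d f x hx hx1 (hslope 0 (by omega))
    have hi1 : i ≠ 1 := by rintro rfl; exact hD1.ne' hDi
    have hi2 : i ≠ 2 := by rintro rfl; exact hD2.ne' hDi
    obtain ⟨n₁, rfl⟩ : ∃ n₁, i = n₁ + 2 := ⟨i - 2, by omega⟩
    set d' : ℕ → ℕ := fun k => d (k + (n₁ + 3)) with hd'_def
    set f' : ℕ → ℕ := fun k => f (k + (n₁ + 3)) with hf'_def
    obtain ⟨n₂, hm', hn₂, hroot', hslope', hc, -⟩ :=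
      degenerate_split d f m n₁ x hx hx1 hslope him hDi hroot d' f' (fun _ => rfl) (fun _ => rfl)
    -- the two blocks are positive by induction
    have hlead := ih (n₁ + 2) (by omega) (by omega) (by omega) d f (fun k hk => hslope k (by omega)) hDi
    have htrail := ih (n₂ + 2) (by omega) (by omega) (by omega) d' f' hslope' hroot'
    rw [show n₁ + 2 - 1 = n₁ + 1 by omega] at hlead
    rw [show n₂ + 2 - 1 = n₂ + 1 by omega] at htrail
    rw [hm', show n₁ + n₂ + 5 - 1 = n₁ + n₂ + 4 by omega,
      slopeEnergy_split d f x hx n₁ n₂ d' f' (fun _ => rfl) (fun _ => rfl) hDi]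
    have hC : 0 < (x ^ (2 * f (n₁ + 1)) * (pathDet (fun _ => (1 : ℝ)) d (fun _ => (1 : ℝ)) f (n₁ + 1)).eval x) ^ 2 /
        x ^ (2 * ∑ j ∈ range (n₁ + 3), f j) := div_pos (by positivity) (pow_pos hx _)
    have := mul_pos hC htrail
    linarith
  · -- NON-DEGENERATE ZERO: g18's separation-free law for `m ≤ 8`, converted from the balance form
    push Not at hdeg
    have hbal := slopeEnergy_balance_pos_of_le_eight d f m hm hm8 x hx
      (fun k hk => pow_lt_pow_right_of_lt_one₀ hx hx1 (hslope k hk)) hroot hdeg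
    have hlog : log x < 0 := log_neg hx hx1
    have hrw : ∑ k ∈ range (m - 1), (((d k + d (k + 1) : ℕ) : ℝ) - 2 * (f k : ℝ)) * log x *
        ((pathDet (fun _ => (1 : ℝ)) d (fun _ => (1 : ℝ)) f k).eval x * (pathDet (fun _ => (1 : ℝ)) d (fun _ => (1 : ℝ)) f (k + 1)).eval x /
          x ^ (2 * ∑ j ∈ range k, f j)) = (-log x) * ∑ k ∈ range (m - 1), ((2 * (f k : ℝ)) - ((d k + d (k + 1) : ℕ) : ℝ)) *
        ((pathDet (fun _ => (1 : ℝ)) d (fun _ => (1 : ℝ)) f k).eval x * (pathDet (fun _ => (1 : ℝ)) d (fun _ => (1 : ℝ)) f (k + 1)).eval x /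
          x ^ (2 * ∑ j ∈ range k, f j)) := by
      rw [mul_sum]; exact sum_congr rfl fun k _ => by ring
    rw [hrw] at hbal
    exact (pos_iff_pos_of_mul_pos hbal).1 (by linarith)

/-- **CROSSING-DIRECTION LAW AT EVERY ZERO, ALL SIZES, WEAK SEPARATION**: below the resonance, all slopes positive, at every zero `x` of `D_m`
(`m ≥ 3`, degenerate or not) at which no two NEGATIVE pivot products `D_kD_{k+1}(x) < 0`, `D_{k+3}D_{k+4}(x) < 0` are three edges apart, the slope
energy is positive.  (The weak «no N J A N» hypothesis passes to both blocks of a degenerate zero; at a non-degenerate zero it is g18's hypothesis of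
`slopeEnergy_pos_below_one`.  It is genuinely needed from `m = 9` on: memo CROSSING-DIRECTION-liftp1g18.md §3.) [this file] -/
theorem slopeEnergy_pos_below_one_of_weakSep (m : ℕ) (hm : 3 ≤ m) (x : ℝ) (hx : 0 < x) (hx1 : x < 1)
    (hslope : ∀ k, k + 1 < m → d k + d (k + 1) < 2 * f k)
    (hroot : (pathDet (fun _ => (1 : ℝ)) d (fun _ => (1 : ℝ)) f m).eval x = 0)
    (hsep : ∀ k, k + 4 < m →
      (pathDet (fun _ => (1 : ℝ)) d (fun _ => (1 : ℝ)) f k).eval x * (pathDet (fun _ => (1 : ℝ)) d (fun _ => (1 : ℝ)) f (k + 1)).eval x < 0 →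
      (pathDet (fun _ => (1 : ℝ)) d (fun _ => (1 : ℝ)) f (k + 3)).eval x * (pathDet (fun _ => (1 : ℝ)) d (fun _ => (1 : ℝ)) f (k + 4)).eval x < 0 →
      False) :
    0 < ∑ k ∈ range (m - 1), ((2 * (f k : ℝ)) - ((d k + d (k + 1) : ℕ) : ℝ)) *
      ((pathDet (fun _ => (1 : ℝ)) d (fun _ => (1 : ℝ)) f k).eval x * (pathDet (fun _ => (1 : ℝ)) d (fun _ => (1 : ℝ)) f (k + 1)).eval x /
        x ^ (2 * ∑ j ∈ range k, f j)) := by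
  revert d f
  induction m using Nat.strong_induction_on with
  | _ m ih =>
  intro d f hslope hroot hsep
  by_cases hdeg : ∃ k, 0 < k ∧ k < m ∧ (pathDet (fun _ => (1 : ℝ)) d (fun _ => (1 : ℝ)) f k).eval x = 0
  · -- DEGENERATE ZERO
    obtain ⟨i, hi0, him, hDi⟩ := hdeg
    obtain ⟨hD1, hD2⟩ := eval_two_pos_below_one d f x hx hx1 (hslope 0 (by omega))
    have hi1 : i ≠ 1 := by rintro rfl; exact hD1.ne' hDi
    have hi2 : i ≠ 2 := by rintro rfl; exact hD2.ne' hDi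
    obtain ⟨n₁, rfl⟩ : ∃ n₁, i = n₁ + 2 := ⟨i - 2, by omega⟩
    set d' : ℕ → ℕ := fun k => d (k + (n₁ + 3)) with hd'_def
    set f' : ℕ → ℕ := fun k => f (k + (n₁ + 3)) with hf'_def
    obtain ⟨n₂, hm', hn₂, hroot', hslope', hc, hprod⟩ :=
      degenerate_split d f m n₁ x hx hx1 hslope him hDi hroot d' f' (fun _ => rfl) (fun _ => rfl)
    have hc2 : 0 < (x ^ (2 * f (n₁ + 1)) * (pathDet (fun _ => (1 : ℝ)) d (fun _ => (1 : ℝ)) f (n₁ + 1)).eval x) ^ 2 := by positivity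
    -- weak separation passes to the blocks
    have hsep₁ : ∀ k, k + 4 < n₁ + 2 →
        (pathDet (fun _ => (1 : ℝ)) d (fun _ => (1 : ℝ)) f k).eval x * (pathDet (fun _ => (1 : ℝ)) d (fun _ => (1 : ℝ)) f (k + 1)).eval x < 0 →
        (pathDet (fun _ => (1 : ℝ)) d (fun _ => (1 : ℝ)) f (k + 3)).eval x * (pathDet (fun _ => (1 : ℝ)) d (fun _ => (1 : ℝ)) f (k + 4)).eval x < 0 →
        False := fun k hk => hsep k (by omega)
    have hsep₂ : ∀ k, k + 4 < n₂ + 2 →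
        (pathDet (fun _ => (1 : ℝ)) d' (fun _ => (1 : ℝ)) f' k).eval x * (pathDet (fun _ => (1 : ℝ)) d' (fun _ => (1 : ℝ)) f' (k + 1)).eval x < 0 →
        (pathDet (fun _ => (1 : ℝ)) d' (fun _ => (1 : ℝ)) f' (k + 3)).eval x * (pathDet (fun _ => (1 : ℝ)) d' (fun _ => (1 : ℝ)) f' (k + 4)).eval x < 0 →
        False := by
      intro k hk hneg hneg3
      have e0 := hprod k
      have e3 := hprod (k + 3)
      refine hsep (n₁ + 3 + k) (by omega) ?_ ?_
      · rw [e0]; exact mul_neg_of_pos_of_neg hc2 hneg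
      · rw [show n₁ + 3 + k + 3 = n₁ + 3 + (k + 3) by omega, show n₁ + 3 + k + 4 = n₁ + 3 + (k + 3) + 1 by omega, e3,
          show k + 3 + 1 = k + 4 by omega]
        exact mul_neg_of_pos_of_neg hc2 hneg3
    have hlead := ih (n₁ + 2) (by omega) (by omega) d f (fun k hk => hslope k (by omega)) hDi hsep₁
    have htrail := ih (n₂ + 2) (by omega) (by omega) d' f' hslope' hroot' hsep₂
    rw [show n₁ + 2 - 1 = n₁ + 1 by omega] at hlead
    rw [show n₂ + 2 - 1 = n₂ + 1 by omega] at htrail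
    rw [hm', show n₁ + n₂ + 5 - 1 = n₁ + n₂ + 4 by omega,
      slopeEnergy_split d f x hx n₁ n₂ d' f' (fun _ => rfl) (fun _ => rfl) hDi]
    have hC : 0 < (x ^ (2 * f (n₁ + 1)) * (pathDet (fun _ => (1 : ℝ)) d (fun _ => (1 : ℝ)) f (n₁ + 1)).eval x) ^ 2 /
        x ^ (2 * ∑ j ∈ range (n₁ + 3), f j) := div_pos hc2 (pow_pos hx _)
    have := mul_pos hC htrail
    linarith
  · -- NON-DEGENERATE ZERO: g18 `slopeEnergy_pos_below_one` with the strong separation form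
    push Not at hdeg
    refine slopeEnergy_pos_below_one d f m hm x hx hx1 hslope hroot hdeg fun k hk hneg => ?_
    rcases lt_trichotomy ((pathDet (fun _ => (1 : ℝ)) d (fun _ => (1 : ℝ)) f (k + 3)).eval x *
        (pathDet (fun _ => (1 : ℝ)) d (fun _ => (1 : ℝ)) f (k + 4)).eval x) 0 with h | h | h
    · exact (hsep k hk hneg h).elim
    · exact (mul_ne_zero (hdeg (k + 3) (by omega) (by omega)) (hdeg (k + 4) (by omega) (by omega)) h).elim
    · exact h

/-! ### 6. Consequences at every zero: negative type and the derivative sign (`m ≤ 8`) -/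

/-- **NEGATIVE TYPE AT EVERY ZERO (`3 ≤ m ≤ 8`)**: below the resonance, all slopes positive, at every zero `t` of `D_m` every non-zero kernel vector
`u` of the evaluated pencil has `P_u′(t) < 0` — g18's `negType_below_one_of_le_eight` without the non-degeneracy hypothesis. [this file] -/
theorem negType_below_one_sharp (m : ℕ) (hm : 3 ≤ m) (hm8 : m ≤ 8) (t : ℝ) (ht : 0 < t) (ht1 : t < 1)
    (hslope : ∀ k, k + 1 < m → d k + d (k + 1) < 2 * f k)
    (hroot : (pathDet (fun _ => (1 : ℝ)) d (fun _ => (1 : ℝ)) f m).eval t = 0)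
    (u : Fin m → ℝ) (hu : (∑ κ, t ^ unitExponent d f m κ • unitLetter m κ) *ᵥ u = 0) (hu0 : u ≠ 0) :
    (derivative (∑ κ, C (u ⬝ᵥ (unitLetter m κ *ᵥ u)) * (X : ℝ[X]) ^ unitExponent d f m κ)).eval t < 0 := by
  have hE := slopeEnergy_pos_below_one_of_le_eight d f m hm hm8 t ht ht1 hslope hroot
  obtain ⟨n, rfl⟩ : ∃ n, m = n + 2 := ⟨m - 2, by omega⟩
  rw [show n + 2 - 1 = n + 1 from rfl] at hE
  exact negType_of_slopeEnergy_pos d f n t ht hroot hE u hu hu0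

/-- **Jacobi step ⇒ derivative sign** (all sizes): at a zero `x > 0` of `D_{n+2}` with positive slope energy, `D′_{n+2}(x)·D_{n+1}(x) < 0`.
[this file; the algebra of g18 `deriv_mul_prev_neg_below_one`] -/
theorem deriv_mul_prev_neg_of_slopeEnergy_pos (n : ℕ) (x : ℝ) (hx : 0 < x)
    (hroot : (pathDet (fun _ => (1 : ℝ)) d (fun _ => (1 : ℝ)) f (n + 2)).eval x = 0)
    (hE : 0 < ∑ k ∈ range (n + 1), ((2 * (f k : ℝ)) - ((d k + d (k + 1) : ℕ) : ℝ)) *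
      ((pathDet (fun _ => (1 : ℝ)) d (fun _ => (1 : ℝ)) f k).eval x * (pathDet (fun _ => (1 : ℝ)) d (fun _ => (1 : ℝ)) f (k + 1)).eval x /
        x ^ (2 * ∑ j ∈ range k, f j))) :
    (derivative (pathDet (fun _ => (1 : ℝ)) d (fun _ => (1 : ℝ)) f (n + 2))).eval x *
      (pathDet (fun _ => (1 : ℝ)) d (fun _ => (1 : ℝ)) f (n + 1)).eval x < 0 := by
  have hJ := deriv_mul_prev_eq_neg_slopeEnergy d f n x hx hroot
  have hneg : x * ((pathDet (fun _ => (1 : ℝ)) d (fun _ => (1 : ℝ)) f (n + 1)).eval x *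
      (derivative (pathDet (fun _ => (1 : ℝ)) d (fun _ => (1 : ℝ)) f (n + 2))).eval x) / x ^ (2 * ∑ j ∈ range (n + 1), f j) < 0 := by
    rw [hJ]; linarith
  have hxF : 0 < x ^ (2 * ∑ j ∈ range (n + 1), f j) := pow_pos hx _
  have h1 : x * ((pathDet (fun _ => (1 : ℝ)) d (fun _ => (1 : ℝ)) f (n + 1)).eval x *
      (derivative (pathDet (fun _ => (1 : ℝ)) d (fun _ => (1 : ℝ)) f (n + 2))).eval x) < 0 := by
    rcases lt_or_ge (x * ((pathDet (fun _ => (1 : ℝ)) d (fun _ => (1 : ℝ)) f (n + 1)).eval x *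
      (derivative (pathDet (fun _ => (1 : ℝ)) d (fun _ => (1 : ℝ)) f (n + 2))).eval x)) 0 with h | h
    · exact h
    · exact absurd hneg (not_lt.2 (div_nonneg h hxF.le))
  rw [mul_comm]
  have h2 := (pos_iff_pos_of_mul_pos (show 0 < x * -((pathDet (fun _ => (1 : ℝ)) d (fun _ => (1 : ℝ)) f (n + 1)).eval x *
      (derivative (pathDet (fun _ => (1 : ℝ)) d (fun _ => (1 : ℝ)) f (n + 2))).eval x) by linarith)).1 hx
  linarith

/-- **DERIVATIVE-SIGN LAW AT EVERY ZERO (`3 ≤ m ≤ 8`)**: below the resonance, all slopes positive, at EVERY zero `x` of `D_m`: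
`D′_m(x)·D_{m−1}(x) < 0`.  In particular every zero of `D_m` in `(0,1)` is simple. [this file] -/
theorem deriv_mul_prev_neg_below_one_sharp (m : ℕ) (hm : 3 ≤ m) (hm8 : m ≤ 8) (x : ℝ) (hx : 0 < x) (hx1 : x < 1)
    (hslope : ∀ k, k + 1 < m → d k + d (k + 1) < 2 * f k)
    (hroot : (pathDet (fun _ => (1 : ℝ)) d (fun _ => (1 : ℝ)) f m).eval x = 0) :
    (derivative (pathDet (fun _ => (1 : ℝ)) d (fun _ => (1 : ℝ)) f m)).eval x *
      (pathDet (fun _ => (1 : ℝ)) d (fun _ => (1 : ℝ)) f (m - 1)).eval x < 0 := by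
  have hE := slopeEnergy_pos_below_one_of_le_eight d f m hm hm8 x hx hx1 hslope hroot
  obtain ⟨n, rfl⟩ : ∃ n, m = n + 2 := ⟨m - 2, by omega⟩
  rw [show n + 2 - 1 = n + 1 by omega] at hE ⊢
  exact deriv_mul_prev_neg_of_slopeEnergy_pos d f n x hx hroot hE

/-- **SIMPLE ZEROS (`3 ≤ m ≤ 8`)**: below the resonance, all slopes positive, EVERY zero of `D_m` in `(0,1)` has root multiplicity one. [this file] -/
theorem rootMultiplicity_eq_one_sharp (m : ℕ) (hm : 3 ≤ m) (hm8 : m ≤ 8) (t : ℝ) (ht : 0 < t) (ht1 : t < 1)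
    (hslope : ∀ k, k + 1 < m → d k + d (k + 1) < 2 * f k)
    (hroot : (pathDet (fun _ => (1 : ℝ)) d (fun _ => (1 : ℝ)) f m).eval t = 0) :
    (pathDet (fun _ => (1 : ℝ)) d (fun _ => (1 : ℝ)) f m).rootMultiplicity t = 1 := by
  have hder := deriv_mul_prev_neg_below_one_sharp d f m hm hm8 t ht ht1 hslope hroot
  have hP0 : pathDet (fun _ => (1 : ℝ)) d (fun _ => (1 : ℝ)) f m ≠ 0 := by
    intro h0
    rw [h0, derivative_zero, eval_zero, zero_mul] at hder
    exact lt_irrefl _ hder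
  have hpos : 0 < (pathDet (fun _ => (1 : ℝ)) d (fun _ => (1 : ℝ)) f m).rootMultiplicity t :=
    (rootMultiplicity_pos hP0).2 hroot
  have hle : ¬ 1 < (pathDet (fun _ => (1 : ℝ)) d (fun _ => (1 : ℝ)) f m).rootMultiplicity t := by
    rw [one_lt_rootMultiplicity_iff_isRoot hP0]
    rintro ⟨-, h2⟩
    rw [IsRoot.def] at h2
    rw [h2, zero_mul] at hder
    exact lt_irrefl _ hder
  omega

end StaticTridiagonalRealUnit
end Summit.ValiantsHypothesis.ValiantsHypothesis.Theorems.KPlusLogSqLaw
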